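import Literature.Computability.ImplicitComplexity.SoftTypeAssignmentWeightedTy
import Literature.Computability.ImplicitComplexity.SoftTypeAssignmentStrengthen
import HarnessLib

/-!
# Generation lemmas for `STA₊`: boxes behind modal types, abstractions behind arrow types

Continuation of the weighted-derivation files (GMR08 = Gaboardi–Marion–Ronchi Della Rocca 2008,
GR07 = Gaboardi–Ronchi Della Rocca 2007). Two inversion principles of `STA`/`STA₊` derivations,
with their effect on the measures:

* `WTyping.box` — **GMR08 Property 2** (Property 1 for `STA`): a derivation of a MODAL type
  `Γ ⊢ N : !σ` is, up to the administrative rules below it, an `(sp)` box: there is a context `Γ₀`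
  with `Γ = !Γ₀` plus linear assumptions on absent variables, and a derivation `Γ₀ ⊢ N : σ` of
  degree `d - 1` and weight `W / r` (`(m)` below the box is replayed below the un-boxed
  derivation, `(w)` contributes the linear junk). For a context without junk (every declared slot
  free in `N`) the decomposition is exact, `Γ = !Γ₀` (`WTyping.box_tight`), and it iterates
  (`WTyping.unbox_iter`).
* `WTyping.gen_lam` — **generation for abstractions** (GR07 Generation Lemma): a derivation of
  `Γ ⊢ λx.P : σ ⊸ A` ends with `(⊸I)` followed by `(w)`, `(m)`, `(∀I)`, `(∀E)` only, so
  `Γ, x : σ ⊢ P : A` is derivable with the same degree and weight one less. The `(∀I)/(∀E)` pairs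
  of the tail are eliminated by the type substitution lemma; to make the induction go through the
  statement is generalised over a type substitution `θ` and over the opening of outermost
  quantifiers (`LinTy.Opens`), `WTyping.gen_lam_opens`.

## References

* [GaboardiMarionRonchidellarocca2008] GMR08, Property 1, Property 2, §3.1.
* [GaboardiRonchiDellaRocca2007] GR07, Generation Lemma and Substitution Lemma.
-/

namespace Literature.Computability.ImplicitComplexity

namespace STA

namespace WTyping

variable {r : ℕ}

/-! ### Boxes behind modal types (Property 2) -/

/-- **GMR08 Property 2.** A derivation of a modal type decomposes as a box: if
`Π ▹ Γ ⊢ N : !ᵏ⁺¹B` (degree `d`, weight `w`) then `d = d₀ + 1`, `w = r · w₀` and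
`Γ₀ ⊢ N : !ᵏ B` with degree `d₀`, weight `w₀`, where every slot of `Γ` is either the `!` of the
slot of `Γ₀` or a linear assumption absent from `Γ₀`. [cite: GaboardiMarionRonchidellarocca2008, Property 2] -/
theorem box {w d : ℕ} {Γ : Ctx} {N : Term} {σ : SoftTy} (h : WTyping r w d Γ N σ) :
    ∀ {k : ℕ} {B : LinTy}, σ = ⟨k + 1, B⟩ →
      ∃ Γ₀ : Ctx, ∃ w₀ d₀ : ℕ, d = d₀ + 1 ∧ w = r * w₀ ∧ WTyping r w₀ d₀ Γ₀ N ⟨k, B⟩ ∧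
        ∀ i, Γ i = (Γ₀ i).map SoftTy.bang ∨ (Γ₀ i = none ∧ ∃ A, Γ i = some ⟨0, A⟩) := by
  induction h with
  | ax _ => intro k B e; cases e
  | @weak w d Γ Γ' M τ j A _ hj hΓ' ih =>
    intro k B e
    subst hΓ'
    obtain ⟨Γ₀, w₀, d₀, rfl, rfl, h₀, hrel⟩ := ih e
    have hj₀ : Γ₀ j = none := by
      rcases hrel j with h1 | ⟨h1, _⟩
      · rw [hj] at h1
        cases hΓ₀ : Γ₀ j with
        | none => rfl
        | some _ => simp [hΓ₀] at h1
      · exact h1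
    refine ⟨Γ₀, w₀, d₀, rfl, rfl, h₀, fun i => ?_⟩
    by_cases hij : i = j
    · subst hij
      exact Or.inr ⟨hj₀, A, by simp⟩
    · rw [Function.update_of_ne hij]
      exact hrel i
  | lam _ _ => intro k B e; cases e
  | app _ _ _ _ _ => intro k B e; cases e
  | @mpx w d Γ Γ' M M' μ σ S j hM hS hj hr hΓ' hM' ih =>
    intro k B e
    subst hΓ' hM'
    obtain ⟨Γ₀, w₀, d₀, rfl, rfl, h₀, hrel⟩ := ih e
    have hjS : j ∉ S := fun h => by simpa [hj] using hS j h
    have hj₀ : Γ₀ j = none := by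
      rcases hrel j with h1 | ⟨h1, _⟩
      · rw [hj] at h1
        cases hΓ₀ : Γ₀ j with
        | none => rfl
        | some _ => simp [hΓ₀] at h1
      · exact h1
    obtain ⟨m, A⟩ := σ
    cases m with
    | zero =>
      -- the contracted slots are linear junk: they are absent from `Γ₀`, the term is unchanged
      have hS₀ : ∀ i ∈ S, Γ₀ i = none := by
        intro i hi
        rcases hrel i with h1 | ⟨h1, _⟩
        · rw [hS i hi] at h1
          cases hΓ₀ : Γ₀ i with
          | none => rfl
          | some τ => simp [hΓ₀, SoftTy.bang] at h1
        · exact h1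
      have eM : M.rename (mpxRen S j) = M :=
        Term.rename_mpxRen_of_disjoint j fun i hi hiS => h₀.ne_none_of_mem_fv hi (hS₀ i hiS)
      rw [eM]
      refine ⟨Function.update Γ₀ j (some ⟨0, A⟩), w₀, d₀, rfl, rfl, h₀.weaken hj₀ ⟨0, A⟩, fun i => ?_⟩
      by_cases hiS : i ∈ S
      · have hij : i ≠ j := fun e => hjS (e ▸ hiS)
        left
        rw [Ctx.mpx_of_mem Γ _ hiS, Function.update_of_ne hij, hS₀ i hiS]
        rfl
      · by_cases hij : i = j
        · subst hij
          left
          rw [Ctx.mpx_self Γ _ hiS]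
          simp [SoftTy.bang]
        · rw [Ctx.mpx_of_ne Γ _ hiS hij, Function.update_of_ne hij]
          exact hrel i
    | succ m =>
      -- the contracted slots are banged: replay the multiplexor below the box
      have hS₀ : ∀ i ∈ S, Γ₀ i = some ⟨m, A⟩ := by
        intro i hi
        rcases hrel i with h1 | ⟨_, A', h2⟩
        · rw [hS i hi] at h1
          cases hΓ₀ : Γ₀ i with
          | none => simp [hΓ₀] at h1
          | some τ =>
            obtain ⟨m', A''⟩ := τ
            simp only [hΓ₀, Option.map_some, SoftTy.bang, Option.some.injEq, SoftTy.mk.injEq,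
              Nat.add_right_cancel_iff] at h1
            rw [h1.1, h1.2]
        · rw [hS i hi] at h2
          cases h2
      refine ⟨Γ₀.mpx S j ⟨m, A⟩, w₀, d₀, rfl, rfl, WTyping.mpx S j h₀ hS₀ hj₀ hr rfl rfl, fun i => ?_⟩
      by_cases hiS : i ∈ S
      · left
        rw [Ctx.mpx_of_mem Γ _ hiS, Ctx.mpx_of_mem Γ₀ _ hiS]
        rfl
      · by_cases hij : i = j
        · subst hij
          left
          rw [Ctx.mpx_self Γ _ hiS, Ctx.mpx_self Γ₀ _ hiS]
          rfl
        · rw [Ctx.mpx_of_ne Γ _ hiS hij, Ctx.mpx_of_ne Γ₀ _ hiS hij]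
          exact hrel i
  | @sp w d Γ Γ' M k A hM hΓ' _ =>
    intro k' B e
    subst hΓ'
    cases e
    exact ⟨Γ, w, d, rfl, rfl, hM, fun i => Or.inl rfl⟩
  | allI _ _ => intro k B e; cases e
  | allE _ _ => intro k B e; cases e
  | sum _ _ _ _ => intro k B e; cases e

/-- A context is tight for `M` when every declared slot is free in `M`. [folklore] -/
def _root_.Literature.Computability.ImplicitComplexity.STA.Ctx.Tight (Γ : Ctx) (M : Term) : Prop :=
  ∀ i, Γ i ≠ none → i ∈ M.fv

/-- Restricted contexts are tight. [folklore] -/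
theorem _root_.Literature.Computability.ImplicitComplexity.STA.Ctx.tight_restrict (Γ : Ctx) (M : Term) :
    (Γ.restrict M.fv).Tight M := fun i hi => by
  by_contra h
  exact hi (by simp [h])

/-- **Property 2, tight form**: for a context without junk the box decomposition is exact,
`Γ = !Γ₀`, and `Γ₀` is again tight. [cite: GaboardiMarionRonchidellarocca2008, Property 2] -/
theorem box_tight {w d : ℕ} {Γ : Ctx} {N : Term} {k : ℕ} {B : LinTy}
    (h : WTyping r w d Γ N ⟨k + 1, B⟩) (ht : Γ.Tight N) :
    ∃ Γ₀ : Ctx, ∃ w₀ d₀ : ℕ, d = d₀ + 1 ∧ w = r * w₀ ∧ Γ = Γ₀.bang ∧ Γ₀.Tight N ∧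
      WTyping r w₀ d₀ Γ₀ N ⟨k, B⟩ := by
  obtain ⟨Γ₀, w₀, d₀, hd, hw, h₀, hrel⟩ := h.box rfl
  have hΓ : ∀ i, Γ i = (Γ₀ i).map SoftTy.bang := by
    intro i
    rcases hrel i with h1 | ⟨h1, A, h2⟩
    · exact h1
    · exact absurd (h₀.not_mem_fv_of_eq_none h1) (not_not.2 (ht i (by simp [h2])))
  refine ⟨Γ₀, w₀, d₀, hd, hw, funext hΓ, fun i hi => ht i ?_, h₀⟩
  rw [hΓ i]
  simpa using hi

/-- Iterating Property 2: a tight derivation of `!ᵏ B` is `k` nested boxes around a tight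
derivation of `B`, of degree `d - k` and weight `w / rᵏ`. [cite: GaboardiMarionRonchidellarocca2008, Property 2] -/
theorem unbox_iter {k : ℕ} : ∀ {w d : ℕ} {Γ : Ctx} {N : Term} {B : LinTy},
    WTyping r w d Γ N ⟨k, B⟩ → Γ.Tight N →
      ∃ Γ₀ : Ctx, ∃ w₀ d₀ : ℕ, d = d₀ + k ∧ w = r ^ k * w₀ ∧ Γ = Ctx.bang^[k] Γ₀ ∧ Γ₀.Tight N ∧
        WTyping r w₀ d₀ Γ₀ N ⟨0, B⟩ := by
  induction k with
  | zero =>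
    intro w d Γ N B h ht
    exact ⟨Γ, w, d, by simp, by simp, rfl, ht, h⟩
  | succ k ih =>
    intro w d Γ N B h ht
    obtain ⟨Γ₁, w₁, d₁, rfl, rfl, rfl, ht₁, h₁⟩ := h.box_tight ht
    obtain ⟨Γ₀, w₀, d₀, rfl, rfl, rfl, ht₀, h₀⟩ := ih h₁ ht₁
    refine ⟨Γ₀, w₀, d₀, by omega, by ring, ?_, ht₀, h₀⟩
    rw [Function.iterate_succ_apply']

/-! ### Opening outermost quantifiers -/

/-- `C.Opens D`: `D` is obtained from the linear type `C` by instantiating its outermost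
quantifiers one after the other (`∀α.B ↦ B[A/α] ↦ …`), i.e. by a chain of `(∀E)` rules.
[cite: GaboardiMarionRonchidellarocca2008, Table 2 (∀E)] -/
inductive _root_.Literature.Computability.ImplicitComplexity.STA.LinTy.Opens : LinTy → LinTy → Prop
  | refl (C : LinTy) : LinTy.Opens C C
  | inst {B : LinTy} (A : LinTy) {D : LinTy} (h : LinTy.Opens (B.inst A) D) : LinTy.Opens (.all B) D

/-- Extend a type substitution by a new value for index `0`. [folklore] -/
def _root_.Literature.Computability.ImplicitComplexity.STA.LinTy.scons (A : LinTy) (θ : ℕ → LinTy) : ℕ → LinTy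
  | 0 => A
  | i + 1 => θ i

/-- Instantiating after a lifted substitution is substituting the extended substitution.
[folklore] -/
theorem _root_.Literature.Computability.ImplicitComplexity.STA.LinTy.inst_substp_up (B A : LinTy) (θ : ℕ → LinTy) :
    (B.substp (LinTy.up θ)).inst A = B.substp (LinTy.scons A θ) := by
  unfold LinTy.inst
  rw [LinTy.substp_substp]
  congr 1
  funext i
  cases i with
  | zero => rfl
  | succ i =>
    show ((θ i).rename Nat.succ).substp _ = θ i
    rw [LinTy.substp_rename]
    exact LinTy.substp_tvar (θ i)

/-- A shifted context under an extended substitution forgets the new value. [folklore] -/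
theorem _root_.Literature.Computability.ImplicitComplexity.STA.Ctx.substT_scons_shift (Γ : Ctx) (A : LinTy) (θ : ℕ → LinTy) :
    (Γ.shift).substT (LinTy.scons A θ) = Γ.substT θ := by
  funext i
  simp only [Ctx.substT_apply, Ctx.shift, Option.map_map]
  congr 1
  funext σ
  simp only [Function.comp_apply, SoftTy.shift, SoftTy.substT, LinTy.substp_rename]
  rfl

/-- The identity type substitution on contexts. [folklore] -/
theorem _root_.Literature.Computability.ImplicitComplexity.STA.Ctx.substT_tvar (Γ : Ctx) : Γ.substT LinTy.tvar = Γ := by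
  funext i
  cases h : Γ i with
  | none => simp [h]
  | some σ => simp [h, SoftTy.substT, LinTy.substp_tvar]

/-! ### Generation for abstractions -/

/-- **Generation lemma for abstractions, generalised form.** If `Π ▹ Γ ⊢ λx.P : C` (degree `d`,
weight `w`) and, after a type substitution `θ`, the type `C[θ]` opens to an arrow `σ ⊸ A`
(`σ = !ᵏB`), then `Γ[θ], x : σ ⊢ P : A` with degree `d` and weight `w - 1`: the tail of
`(w) (m) (∀I) (∀E)` rules below the `(⊸I)` of `Π` is replayed on the body, `(∀I)/(∀E)` being
absorbed into `θ`. [cite: GaboardiRonchiDellaRocca2007, Generation Lemma] -/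
theorem gen_lam_opens {w d : ℕ} {Γ : Ctx} {M : Term} {σ : SoftTy} (h : WTyping r w d Γ M σ) :
    ∀ {P : Term} {C : LinTy}, M = .lam P → σ = ⟨0, C⟩ →
      ∀ (θ : ℕ → LinTy) {k : ℕ} {B A : LinTy}, (C.substp θ).Opens (.limp k B A) →
        ∃ w₀, w = w₀ + 1 ∧ WTyping r w₀ d (Ctx.cons (some ⟨k, B⟩) (Γ.substT θ)) P ⟨0, A⟩ := by
  induction h with
  | ax _ => intro P C e; cases e
  | @weak w d Γ Γ' M τ j A' _ hj hΓ' ih =>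
    intro P C eM eτ θ k B A ho
    subst hΓ'
    obtain ⟨w₀, rfl, h₀⟩ := ih eM eτ θ ho
    refine ⟨w₀, rfl, ?_⟩
    have := h₀.weaken (j := j + 1) (by simp [Ctx.cons, hj]) ⟨0, A'.substp θ⟩
    rw [Ctx.substT_update, Ctx.cons_update]
    exact this
  | @lam w d Γ M k' B' A' hM _ =>
    intro P C eM eτ θ k B A ho
    cases eM
    cases eτ
    refine ⟨w, rfl, ?_⟩
    have h' := hM.substT θ
    rw [Ctx.substT_cons] at h'
    generalize ho' : (LinTy.limp k' B' A').substp θ = X at ho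
    cases ho with
    | refl _ =>
      cases ho'
      exact h'
    | inst _ _ => cases ho'
  | app _ _ _ _ _ => intro P C e; cases e
  | @mpx w d Γ Γ' M M' μ σ S j _ hS hj hr hΓ' hM' ih =>
    intro P C eM eτ θ k B A ho
    subst hΓ' hM' eτ
    obtain ⟨P₀, rfl⟩ : ∃ P₀, M = .lam P₀ := by
      cases M with
      | lam P₀ => exact ⟨P₀, rfl⟩
      | _ => simp [Term.rename] at eM
    simp only [Term.rename, Term.lam.injEq] at eM
    subst eM
    obtain ⟨w₀, rfl, h₀⟩ := ih rfl rfl θ ho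
    refine ⟨w₀, rfl, WTyping.mpx (σ := σ.substT θ) (S.image Nat.succ) (j + 1) h₀ ?_ ?_
      (Finset.card_image_le.trans hr) ?_ ?_⟩
    · intro i hi
      obtain ⟨i₀, hi₀, rfl⟩ := Finset.mem_image.1 hi
      simp [Ctx.cons, hS i₀ hi₀]
    · simp [Ctx.cons, hj]
    · rw [← Ctx.cons_mpx, Ctx.substT_mpx]
    · rw [liftRen_mpxRen]
  | sp _ _ _ => intro P C _ e; cases e
  | @allI w d Γ Δ M A' _ hΔ ih =>
    intro P C eM eτ θ k B A ho
    subst hΔ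
    cases eτ
    generalize ho' : (LinTy.all A').substp θ = X at ho
    cases ho with
    | refl _ => cases ho'
    | @inst B₁ A₁ D ho₁ =>
      simp only [LinTy.substp, LinTy.all.injEq] at ho'
      subst ho'
      rw [LinTy.inst_substp_up] at ho₁
      obtain ⟨w₀, rfl, h₀⟩ := ih eM rfl (LinTy.scons A₁ θ) ho₁
      refine ⟨w₀, rfl, ?_⟩
      rwa [Ctx.substT_scons_shift] at h₀
  | @allE w d Γ M B' A₁ _ ih =>
    intro P C eM eτ θ k B A ho
    cases eτ
    rw [LinTy.inst_substp] at ho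
    exact ih eM rfl θ (LinTy.Opens.inst _ ho)
  | sum _ _ _ _ => intro P C e; cases e

/-- **Generation lemma for abstractions** (GR07): `Π ▹ Γ ⊢ λx.P : σ ⊸ A` with `σ = !ᵏB` implies
`Γ, x : σ ⊢ P : A` with the same degree and rank bound and weight `W(Π) - 1`.
[cite: GaboardiRonchiDellaRocca2007, Generation Lemma] -/
theorem gen_lam {w d : ℕ} {Γ : Ctx} {P : Term} {k : ℕ} {B A : LinTy}
    (h : WTyping r w d Γ (.lam P) ⟨0, .limp k B A⟩) :
    ∃ w₀, w = w₀ + 1 ∧ WTyping r w₀ d (Ctx.cons (some ⟨k, B⟩) Γ) P ⟨0, A⟩ := by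
  have := h.gen_lam_opens rfl rfl LinTy.tvar (k := k) (B := B) (A := A)
    (by rw [LinTy.substp_tvar]; exact LinTy.Opens.refl _)
  rwa [Ctx.substT_tvar] at this

end WTyping

end STA

end Literature.Computability.ImplicitComplexity
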